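import Summits.NavierStokesRegularity.NavierStokesRegularity.Theses.AxisymmetricExtremality

/-!
# Strategist s20-g9 (independent census, family `-s`) — typed statements for the census
`STRATEGY-CENSUS-s20-g9.md` of crux `AxisymmetricKatoGlobal` (stmt-NavierStokesRegularity-15453).

Nothing here is a line or a stub. The file records, kernel-checked:

* `NoAxisymMinimalDatum` (W): the strictly-weaker intermediate that the route's deciding theorem
  actually consumes, with `noAxisymMinimalDatum_of_AKG : AxisymmetricKatoGlobal → W` and
  `closes_of_W : MinimalDatumPFold → PFoldToAxisymmetric → W → NavierStokesRegularity`
  (same three lines of logic as the route's `closes`).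
* `AxisymBlowupAboveThreshold` (W′, "symmetry costs": every axisymmetric critical blow-up datum
  lies strictly above the Rusin–Šverák threshold) and `noAxisymMinimalDatum_iff_aboveThreshold :
  W ↔ W′` over the tree (`hasGlobalKatoSolution_of_lt_rusinSverakRhoMaxPure`).
* `AxisymKatoGlobalQuantitative` (S⁺): the a-priori-bound strengthening, with `S⁺ → AKG`.

No NS regularity statement is proved here.
-/

set_option linter.dupNamespace false

noncomputable section

open MeasureTheory Set Function
open scoped ENNReal

namespace Summit.NavierStokesRegularity.NavierStokesRegularity.Cruxes.AxisymmetricKatoGlobal.StrategistS20g9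

open Summit.NavierStokesRegularity.NavierStokesRegularity.Theses.AxisymmetricExtremality
open Literature.Analysis.FluidPDE Literature.Analysis

/-- The route's unfolded axisymmetry clause (equivariance under rotations about the `x₂`-axis). -/
def AxisymClause (u₀ : EuclideanSpace ℝ (Fin 3) → EuclideanSpace ℝ (Fin 3)) : Prop :=
  ∀ (θ : ℝ) (x : EuclideanSpace ℝ (Fin 3)),
    u₀ (WithLp.toLp 2 ![Real.cos θ * x 0 - Real.sin θ * x 1, Real.sin θ * x 0 + Real.cos θ * x 1, x 2]) =
      WithLp.toLp 2 ![Real.cos θ * u₀ x 0 - Real.sin θ * u₀ x 1,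
        Real.sin θ * u₀ x 0 + Real.cos θ * u₀ x 1, u₀ x 2]

/-- **W — the weaker intermediate.** No `Ḣ^{1/2}`-minimal blow-up datum (Rusin–Šverák) is
axisymmetric. This is exactly what `closes` consumes from `AxisymmetricKatoGlobal`. -/
def NoAxisymMinimalDatum : Prop :=
  ∀ ν : ℝ, 0 < ν → ∀ (u₀ : EuclideanSpace ℝ (Fin 3) → EuclideanSpace ℝ (Fin 3))
    (g : FunctionSpaces.HomSobolev (EuclideanSpace ℝ (Fin 3)) (EuclideanSpace ℂ (Fin 3)) (1 / 2 : ℝ)),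
    IsMinimalBlowupDatum ν u₀ g → AxisymClause u₀ → False

/-- **W′ — "symmetry costs".** Every axisymmetric critical datum without a global Kato solution has
`Ḣ^{1/2}`-norm strictly above the pure Rusin–Šverák threshold. -/
def AxisymBlowupAboveThreshold : Prop :=
  ∀ ν : ℝ, 0 < ν → ∀ (u₀ : EuclideanSpace ℝ (Fin 3) → EuclideanSpace ℝ (Fin 3))
    (g : FunctionSpaces.HomSobolev (EuclideanSpace ℝ (Fin 3)) (EuclideanSpace ℂ (Fin 3)) (1 / 2 : ℝ)),
    MemLp u₀ 3 volume → g.Represents (FunctionSpaces.EuclideanSpace.complexify ∘ u₀) →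
    IsWeaklyDivFree u₀ → AxisymClause u₀ → ¬ HasGlobalKatoSolution ν u₀ →
    rusinSverakRhoMaxPure ν < ‖g‖ₑ

/-- **S⁺ — the quantitative strengthening.** Axisymmetric critical data have global Kato solutions
whose `L³` norm is bounded for all times by a universal function of `‖u₀‖_{L³}`. -/
def AxisymKatoGlobalQuantitative : Prop :=
  ∃ F : ℝ≥0∞ → ℝ≥0∞, ∀ ν : ℝ, 0 < ν → ∀ (u₀ : EuclideanSpace ℝ (Fin 3) → EuclideanSpace ℝ (Fin 3))
    (g : FunctionSpaces.HomSobolev (EuclideanSpace ℝ (Fin 3)) (EuclideanSpace ℂ (Fin 3)) (1 / 2 : ℝ)),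
    MemLp u₀ 3 volume → g.Represents (FunctionSpaces.EuclideanSpace.complexify ∘ u₀) →
    IsWeaklyDivFree u₀ → AxisymClause u₀ →
    ∃ u : ℝ → EuclideanSpace ℝ (Fin 3) → EuclideanSpace ℝ (Fin 3),
      IsGlobalMildSolution ν 0 u₀ u ∧ ContinuousInLpOn (Ici 0) 3 u ∧ u 0 = u₀ ∧
      AEStronglyMeasurable (uncurry u) (volume.restrict (Ioi 0 ×ˢ univ)) ∧
      ∀ t : ℝ, 0 ≤ t → eLpNorm (u t) 3 volume ≤ F (eLpNorm u₀ 3 volume * ENNReal.ofReal ν⁻¹)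

/-- `AKG → W` (three lines of logic: a minimal datum blows up, AKG says it does not). -/
theorem noAxisymMinimalDatum_of_AKG (h : AxisymmetricKatoGlobal) : NoAxisymMinimalDatum := by
  intro ν hν u₀ g hmin hax
  obtain ⟨hL3, hrep, hdiv, -, hnot⟩ := hmin
  exact hnot (h ν hν u₀ g hL3 hrep hdiv hax)

/-- The route's deciding theorem goes through with `W` in place of `AxisymmetricKatoGlobal`
(verbatim the logic of `Theses.AxisymmetricExtremality.closes`). -/
theorem closes_of_W (h₂ : MinimalDatumPFold) (h₄ : PFoldToAxisymmetric) (hW : NoAxisymMinimalDatum) :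
    NavierStokesRegularity := by
  show Literature.NS.NavierStokesExistenceSmoothR3
  intro ν hν u₀ hsm hdiv hdec
  by_contra hno
  obtain ⟨u₁, g, hmin, hax⟩ := h₄ ν hν (h₂ ν hν ⟨u₀, hsm, hdiv, hdec, hno⟩)
  exact hW ν hν u₁ g hmin hax

/-- `W ↔ W′` over the tree: a blow-up datum has norm `≥ ρ_max^pure`
(`hasGlobalKatoSolution_of_lt_rusinSverakRhoMaxPure`), and `= ρ_max^pure` is minimality. -/
theorem noAxisymMinimalDatum_iff_aboveThreshold :
    NoAxisymMinimalDatum ↔ AxisymBlowupAboveThreshold := by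
  constructor
  · intro hW ν hν u₀ g hL3 hrep hdiv hax hnot
    have hge : rusinSverakRhoMaxPure ν ≤ ‖g‖ₑ :=
      not_lt.1 fun hlt => hnot (hasGlobalKatoSolution_of_lt_rusinSverakRhoMaxPure hL3 hrep hdiv hlt)
    exact lt_of_le_of_ne hge fun heq => hW ν hν u₀ g ⟨hL3, hrep, hdiv, heq.symm, hnot⟩ hax
  · intro hW' ν hν u₀ g hmin hax
    obtain ⟨hL3, hrep, hdiv, heq, hnot⟩ := hmin
    exact (lt_irrefl _) (heq ▸ hW' ν hν u₀ g hL3 hrep hdiv hax hnot)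

/-- `S⁺ → AKG` (drop the bound). -/
theorem AKG_of_quantitative (h : AxisymKatoGlobalQuantitative) : AxisymmetricKatoGlobal := by
  obtain ⟨F, hF⟩ := h
  intro ν hν u₀ g hL3 hrep hdiv hax
  obtain ⟨u, hmild, hcont, h0, hmeas, -⟩ := hF ν hν u₀ g hL3 hrep hdiv hax
  exact ⟨u, hmild, hcont, h0, hmeas⟩

end Summit.NavierStokesRegularity.NavierStokesRegularity.Cruxes.AxisymmetricKatoGlobal.StrategistS20g9

end
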